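import Literature.MathematicalPhysics.QuantumFieldTheory.Balaban1983to89.B7Ineq199General

/-!
# `Balaban1983to89.B7Prop10AsPrinted` — T. Bałaban, *Averaging operations for lattice gauge theories*, Commun. Math. Phys. **98**
(1985) 17–51 [Balaban1985Averaging], Sect. F, **Proposition 10 p. 50 with (203) AND (204) IN PRINT'S SHAPE AT A GENERAL
BACKGROUND, print's constants `β = α₀α₄ + α₃α₄ + α₄²`, `C₅ = 1 + 4C′₅`, `C₄ = 8C′₄C₅` VERBATIM** — the same right-hand sides as the
flat kernel `B7Prop10Flat.prop10_flat` (`C′₄ = B7Prop9Flat.C4'`, `C′₅ = B7Prop9Flat.C5'`, `C₅ = B7Prop10Flat.C5`, `C₄ = B7Prop10Flat.C4`),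
now at an arbitrary `U1`-valued background with (52).

statement-level skeleton of published theorems with citation tags; proofs where landed; nothing here is a claim about the Yang–Mills mass gap

CITATION HEADER (lean-in-tree rule).  Cell `lit-balaban`, unit `lit-balaban-r04` (owner of block B7, gen 5); a KERNEL PIECE for
SKELETON rows `B7.Prop10` (decl of record `B7.Prop10Printed`, abstract; flat kernel `B7Prop10Flat.prop10_flat`; @gen kernels
`B7Prop10General.prop10_general` — constants `C₄ = C4G(d, L)`, `C₆ = C₅ + 1` — and `B7Prop10Printed204.prop10_general_printed204` —
(204) in print's shape) and `B7.Eq201` ((201)–(206)).  Nothing of the abstract carrier `B7.lean` is instantiated; no new definition.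

PRINT (p. 49–50, verbatim).  "Let us denote `β = α₀α₄ + α₃α₄ + α₄²`, `C₅ = 1 + 4C′₅`, `C₄ = 8C′₄C₅`. We will prove by induction that
`|(ũ′ʲ)⁻¹(c₋)R̄ʲ_{0,c}ũ′ʲ(c₊) − 1| < α₄Lʲη + C₄β(Lʲη)²`, (203) `|ũ′ʲ(y) − 1| < α₄ + 2C′₅α₄Lη + … + 2C′₅α₄Lʲη`, `y ∈ Ω^{(j)}`. (204)
Let us notice that `α₄Lʲη + C₄β(Lʲη)² ≦ α₄Lʲη(1 + C₄(α₀ + α₃ + α₄)) ≦ 2α₄Lʲη ≦ 2α₄` for `α₀, α₃, α₄` sufficiently small … We apply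
Proposition 9 with `V₀ = Ū₀ʲ`, `v′ = ũ′ʲ`, `v₁ = \overline{R₀u₁}ʲ`. We have `α₀` replaced by `2α₀(Lʲη)²`, `α′₃` replaced by `α₃Lʲη`,
`α₄` replaced by the right-hand side of (204), which can be bounded by `α₄(1 + 4C′₅) = C₅α₄`, and `α′₄` replaced by the right-hand
side of (203), which can be bounded by `2α₄`. … (205) … (206). Thus we have proved the following  **Proposition 10.** There exist
positive constants `C₄, C₅, c₆` such that for arbitrary configurations `U₀, u′, u₁` satisfying (52), (176), (177), (166), (167) with
`α₀, α₃, α₄ ≦ c₆` the bounds (203), (204) hold for `j ≦ k`.  This result implies in particular that the configuration `u′` belongs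
to the class `Λ_k(C₅α₄)`."

WHAT THIS FILE PROVES (kernel, no `sorry`, standard axioms).  Setting and notation of `B7Prop10General` (`ũ′ʲ = utilG L U₀ u′ u₁ j`,
levels `Ū₀ʲ = avgIter L U₀ j`, `\overline{R₀u₁}ʲ = uavg L U₀ u₁ j`, `t = Lʲη`).
* `prop9_printed_C4'` — Proposition 9 @gen (`B7Ineq199General.prop9_printed`, `B7Ineq200General.eq200_printed`) restated with the
  FLAT kernel's constant `C′₄ = B7Prop9Flat.C4' = 10⁴(d+1)²` (`2400(d+1)(d+4) ≤ 10⁴(d+1)²`) and (200) `≤ α₄ + 6dLα′₄`.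
* `ineq205_printed` — (205): `L·(203)ⱼ + C′₄L²(2α₀t²·(204)ⱼ + α₃t·(203)ⱼ + (203)ⱼ²) ≤ (203)ⱼ₊₁` for `(204)ⱼ ≤ C₅α₄`, `C₄(α₀ + α₃ + α₄) ≤ 1`,
  `L ≥ 2` — exactly print's line "`L⁻¹ + C′₄·4C₅·C₄⁻¹ ≦ 1`" (`C₄ = 8C′₄C₅`: `½ + ½`).
* **`prop10_as_printed`** — for all `j ≤ k`: (203) `‖ũ′ʲ(c₋)⁻¹R̄ʲ_{0,c}ũ′ʲ(c₊) − 1‖ ≤ α₄Lʲη + C₄(α₀α₄ + α₃α₄ + α₄²)(Lʲη)²` AND (204)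
  `‖ũ′ʲ − 1‖ ≤ α₄ + 2C′₅α₄(Lη + … + Lʲη)` (`B7Prop10Flat.rhs204`), under the level hypotheses of `prop10_general` (values in `U1`,
  "`α₀` replaced by `2α₀(Lʲη)²`"), (176) `SiteBd u′ α₄`, (177) `CovBondBd U₀ u′ (α₄η)`, (166)/(167) `InLambda L U₀ u₁ k α₃ η`, and the
  smallness `c₆ = c₆(d, L)`: `20C₅α₄ ≤ 1`, `200dLα₄ ≤ 1`, `C₄(α₀ + α₃ + α₄) ≤ 1`, `α₃ ≤ 1/50`, `1024(d+1)(d+4)L²α₀ ≤ 1`.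
* `prop10_as_printed'` — the closed forms (203)ⱼ `≤ 2α₄Lʲη`, (204)ⱼ `≤ C₅α₄`; `prop10_as_printed_of52` — under (52) via Proposition 2
  (`B7Prop10General.levels_of52`); **`inLambda_C5_of_prop10`** — "`u′` belongs to the class `Λ_k(C₅α₄)`" with print's `C₅` (compare
  `B7Prop10InLambda.inLambda_of_prop10_general`: `C₆ = C₅ + 1`).
PROOF = print's induction, now with both one-step inputs in print's shape: the (203)-step is `prop9_printed_C4'` at `V₀ = Ū₀ʲ` closed by
`ineq205_printed`; the (204)-step is the `α₀`-free (200) (`B7Ineq200General.siteBd_vtilG_printed`) closed by (206) as in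
`B7Prop10Printed204`.  READINGS: those of `B7Ineq199General` (Banach/`U1` carrier, `≤` for `<`, explicit `c₆(d, L)`); constants
`C′₄ = 10⁴(d+1)²`, `C′₅ = 64(d+1)` depend on `d` only (print: "there exist positive constants").  With this file every display of
Proposition 10 is kernel-checked at a general background with the printed constants' structure.
DECLARATIONS: theorems only; imports `B7Ineq199General`.  Unit `lit-balaban-r04` (gen 5), 2026-08-21.

[cite: Balaban1985Averaging, Proposition 10 p.50, (201)–(206) p.49, Proposition 9 (199)–(200) p.49, (166)–(167) p.44, (176)–(179) p.45]
-/

noncomputable section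

open scoped BigOperators
open NormedSpace Finset

namespace Literature.MathematicalPhysics.QuantumFieldTheory.Balaban1983to89.B7Prop10AsPrinted

open B7Prop1Explicit B7Prop2Explicit MatrixLog B7Eq92Concrete B7Eq99Concrete B7Eq84Concrete B7Eq167Flat B7Prop8Flat
  B7Prop9Flat B7Prop9General B7Prop10General B7Prop10InLambda B7Ineq200General B7Ineq199General
open B7Prop10Flat (rhs204 rhs204_zero rhs204_succ rhs204_le C5 C4 one_le_C5 C5'_nonneg C4'_nonneg siteBd_mono)

-- `Site` alone would resolve to the torus sites of `Setup.lean`; re-export the `ℤ^d` sites of `B7Prop1Explicit`.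
export B7Prop1Explicit (Site)

variable {d : ℕ}

variable {𝔸 : Type*} [NormedRing 𝔸] [NormOneClass 𝔸] [NormedAlgebra ℂ 𝔸] [CompleteSpace 𝔸]

/-! ## §1 Proposition 9 @gen with the flat kernel's constants -/

/-- `2400(d+1)(d+4) ≤ C′₄ = 10⁴(d+1)²`: the constant of `B7Ineq199General.eq199_printed` is dominated by the flat kernel's
`B7Prop9Flat.C4'`. [cite: Balaban1985Averaging, Proposition 9 (199) p.49] -/
theorem C4p_le_C4' (d : ℕ) : 2400 * ((d : ℝ) + 1) * ((d : ℝ) + 4) ≤ C4' d := by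
  have hd : (0 : ℝ) ≤ d := Nat.cast_nonneg d
  unfold C4'; nlinarith

/-- **Proposition 9 at a general background in print's shape with the FLAT kernel's constants**: `CovBondBd` of `z ↦ ṽ′(Lz)` at the
averaged background with `Lα′₄ + C′₄L²(α₀α₄ + α′₃α′₄ + α′₄²)`, `C′₄ = B7Prop9Flat.C4'`, and `SiteBd` with `α₄ + 6dLα′₄`
(`B7Ineq199General.prop9_printed`, `C4p_le_C4'`). [cite: Balaban1985Averaging, Proposition 9 (199)–(200) p.49] -/
theorem prop9_printed_C4' {L : ℕ} (hL : 1 ≤ L) {V₀ : Site d → Fin d → 𝔸ˣ} (hV : ∀ x κ, V₀ x κ ∈ U1 𝔸)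
    {α₀ : ℝ} (hα₀ : 0 ≤ α₀)
    (h44 : ∀ (x : Site d) (κ μ : Fin d), κ ≠ μ → ‖((hol V₀ x (plaqWord κ μ) : 𝔸ˣ) : 𝔸) - 1‖ ≤ α₀)
    {v' v₁ : Site d → 𝔸ˣ} {α₃ α₃' α₄ α₄' : ℝ}
    (h4a : SiteBd v' α₄) (h4b : CovBondBd V₀ v' α₄') (h3c : SiteBd v₁ α₃) (h3d : CovBlockBd L V₀ v₁ (L * α₃'))
    (hα₄ : α₄ ≤ 1 / 20) (hα₄' : 0 ≤ α₄') (hα₃ : α₃ ≤ 1 / 50) (hα₃' : 50 * (L * α₃') ≤ 1)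
    (hs : 100 * ((d : ℝ) * L * α₄') ≤ 1) (hα₀s : 512 * ((d : ℝ) + 1) * ((d : ℝ) + 4) * L ^ 2 * α₀ ≤ 1) :
    CovBondBd (B7Prop2Explicit.rescale L (bavg L V₀)) (fun z => vtilG L V₀ v' v₁ ((L : ℤ) • z))
        (L * α₄' + C4' d * L ^ 2 * (α₀ * α₄ + α₃' * α₄' + α₄' ^ 2)) ∧
      SiteBd (fun z => vtilG L V₀ v' v₁ ((L : ℤ) • z)) (α₄ + 6 * d * L * α₄') := by
  have hL0 : 0 < L := lt_of_lt_of_le zero_lt_one hL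
  obtain ⟨hB, hS⟩ := prop9_printed hL hV hα₀ h44 h4a h4b h3c h3d hα₄ hα₄' hα₃ hα₃' hs hα₀s
  refine ⟨covBondBd_mono hB ?_, hS⟩
  have hα₄0 : 0 ≤ α₄ := (norm_nonneg _).trans (h4a 0)
  have hβ0 : 0 ≤ L * α₃' := (norm_nonneg _).trans (h3d 0 fun _ => ⟨0, hL0⟩)
  have hLr : (0 : ℝ) < L := by exact_mod_cast hL0
  have h3 : 0 ≤ α₃' := by nlinarith
  have hq : 0 ≤ (L : ℝ) ^ 2 * (α₀ * α₄ + α₃' * α₄' + α₄' ^ 2) := by positivity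
  have := mul_le_mul_of_nonneg_right (C4p_le_C4' d) hq
  nlinarith

/-! ## §2 (205) with print's constants -/

/-- **(203)ⱼ in closed form** (p. 49: "`α₄Lʲη + C₄β(Lʲη)² ≦ α₄Lʲη(1 + C₄(α₀ + α₃ + α₄)) ≦ 2α₄Lʲη`"): for `t = Lʲη ≤ 1` and
`C₄(α₀ + α₃ + α₄) ≤ 1`, `α₄t + C₄(α₀α₄ + α₃α₄ + α₄²)t² ≤ 2α₄t`. [cite: Balaban1985Averaging, (203)–(204) p.49] -/
theorem rhs203_printed_le {t α₀ α₃ α₄ : ℝ} (ht0 : 0 ≤ t) (ht : t ≤ 1) (hα₄ : 0 ≤ α₄)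
    (hC : C4 d * (α₀ + α₃ + α₄) ≤ 1) :
    α₄ * t + C4 d * (α₀ * α₄ + α₃ * α₄ + α₄ ^ 2) * t ^ 2 ≤ 2 * α₄ * t := by
  have hC4 : 0 ≤ C4 d := by unfold C4 C5; have := C4'_nonneg (d := d); have := C5'_nonneg (d := d); positivity
  have e : C4 d * (α₀ * α₄ + α₃ * α₄ + α₄ ^ 2) * t ^ 2 = (C4 d * (α₀ + α₃ + α₄)) * (α₄ * t) * t := by ring
  rw [e]
  have h1 : (C4 d * (α₀ + α₃ + α₄)) * (α₄ * t) * t ≤ 1 * (α₄ * t) * 1 :=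
    mul_le_mul (mul_le_mul_of_nonneg_right hC (by positivity)) ht ht0 (by positivity)
  linarith

/-- **(205) WITH PRINT'S CONSTANTS** (p. 49): with `t = Lʲη`, `A = (203)ⱼ = α₄t + C₄βt²`, `β = α₀α₄ + α₃α₄ + α₄²`, the site constant
`T = (204)ⱼ ≤ C₅α₄`, and Proposition 9 applied with "`α₀` replaced by `2α₀t²`, `α′₃` by `α₃t`, `α₄` by `T`, `α′₄` by `A`":
`L·A + C′₄L²(2α₀t²·T + α₃t·A + A²) ≤ α₄L^{j+1}η + C₄β(L^{j+1}η)²`, because `A ≤ 2α₄t`, `2C₅α₀α₄ + 2α₃α₄ + 4α₄² ≤ 4C₅β`,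
`C₄ = 8C′₄C₅` and `L ≥ 2` ("if `L⁻¹ + C′₄4C₅C₄⁻¹ ≦ 1`"). [cite: Balaban1985Averaging, (205) p.49] -/
theorem ineq205_printed {L : ℕ} (hL : 2 ≤ L) {t α₀ α₃ α₄ T : ℝ} (ht0 : 0 ≤ t) (ht : t ≤ 1)
    (hα₀ : 0 ≤ α₀) (hα₃ : 0 ≤ α₃) (hα₄ : 0 ≤ α₄) (hT0 : 0 ≤ T) (hT : T ≤ C5 d * α₄)
    (hC : C4 d * (α₀ + α₃ + α₄) ≤ 1) :
    L * (α₄ * t + C4 d * (α₀ * α₄ + α₃ * α₄ + α₄ ^ 2) * t ^ 2) +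
        C4' d * L ^ 2 * ((2 * α₀ * t ^ 2) * T + (α₃ * t) * (α₄ * t + C4 d * (α₀ * α₄ + α₃ * α₄ + α₄ ^ 2) * t ^ 2) +
          (α₄ * t + C4 d * (α₀ * α₄ + α₃ * α₄ + α₄ ^ 2) * t ^ 2) ^ 2)
      ≤ α₄ * (L * t) + C4 d * (α₀ * α₄ + α₃ * α₄ + α₄ ^ 2) * (L * t) ^ 2 := by
  have hC5 := one_le_C5 (d := d)
  have hC4' := C4'_nonneg (d := d)
  have hLr : (2 : ℝ) ≤ L := by exact_mod_cast hL
  set A : ℝ := α₄ * t + C4 d * (α₀ * α₄ + α₃ * α₄ + α₄ ^ 2) * t ^ 2 with hA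
  set β : ℝ := α₀ * α₄ + α₃ * α₄ + α₄ ^ 2 with hβ
  have hβ0 : 0 ≤ β := by rw [hβ]; positivity
  have hC4 : C4 d = 8 * C4' d * C5 d := rfl
  have hC40 : 0 ≤ C4 d := by rw [hC4]; positivity
  have hA2 : A ≤ 2 * α₄ * t := rhs203_printed_le ht0 ht hα₄ hC
  have hA0 : 0 ≤ A := by rw [hA]; positivity
  -- `L·C₄βt² ≤ C₄β(Lt)²/2`
  have e1 : (L : ℝ) * (C4 d * β * t ^ 2) ≤ C4 d * β * (L * t) ^ 2 / 2 := by
    have : C4 d * β * (L * t) ^ 2 / 2 - (L : ℝ) * (C4 d * β * t ^ 2) = C4 d * β * t ^ 2 * (L * (L - 2) / 2) := by ring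
    have h0 : 0 ≤ C4 d * β * t ^ 2 * (L * (L - 2) / 2) := by
      apply mul_nonneg (by positivity); nlinarith
    linarith
  -- the bracket: `2α₀t²T + α₃tA + A² ≤ t²(2C₅α₀α₄ + 2α₃α₄ + 4α₄²) ≤ 4C₅βt²`
  have e2 : (2 * α₀ * t ^ 2) * T + (α₃ * t) * A + A ^ 2 ≤ 4 * C5 d * β * t ^ 2 := by
    have h1 : (2 * α₀ * t ^ 2) * T ≤ (2 * α₀ * t ^ 2) * (C5 d * α₄) := mul_le_mul_of_nonneg_left hT (by positivity)
    have h2 : (α₃ * t) * A ≤ (α₃ * t) * (2 * α₄ * t) := mul_le_mul_of_nonneg_left hA2 (by positivity)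
    have h3 : A ^ 2 ≤ (2 * α₄ * t) ^ 2 := pow_le_pow_left₀ hA0 hA2 2
    have h4 : (2 * α₀ * t ^ 2) * (C5 d * α₄) + (α₃ * t) * (2 * α₄ * t) + (2 * α₄ * t) ^ 2 =
        t ^ 2 * (2 * C5 d * (α₀ * α₄) + 2 * (α₃ * α₄) + 4 * α₄ ^ 2) := by ring
    have h5 : t ^ 2 * (2 * C5 d * (α₀ * α₄) + 2 * (α₃ * α₄) + 4 * α₄ ^ 2) ≤ t ^ 2 * (4 * C5 d * β) := by
      apply mul_le_mul_of_nonneg_left _ (by positivity)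
      rw [hβ]
      have : 0 ≤ α₀ * α₄ := by positivity
      have : 0 ≤ α₃ * α₄ := by positivity
      have : 0 ≤ α₄ ^ 2 := by positivity
      nlinarith
    nlinarith
  have e3 : C4' d * (L : ℝ) ^ 2 * (4 * C5 d * β * t ^ 2) = C4 d * β * (L * t) ^ 2 / 2 := by rw [hC4]; ring
  have hmain : (L : ℝ) * A + C4' d * L ^ 2 * ((2 * α₀ * t ^ 2) * T + (α₃ * t) * A + A ^ 2)
      ≤ α₄ * (L * t) + C4 d * β * (L * t) ^ 2 := by
    have hLA : (L : ℝ) * A = α₄ * (L * t) + L * (C4 d * β * t ^ 2) := by rw [hA, hβ]; ring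
    have hbr := mul_le_mul_of_nonneg_left e2 (by positivity : (0 : ℝ) ≤ C4' d * L ^ 2)
    rw [hLA]; linarith
  simpa only [hA, hβ] using hmain

/-! ## §3 Proposition 10 with (203) and (204) in print's shape -/

/-- **PROPOSITION 10 AT A GENERAL BACKGROUND, (203) AND (204) AS PRINTED** (p. 50; (203)–(206) p. 49): under the level hypotheses of
`B7Prop10General.prop10_general` (`Ū₀ʲ` with values in `U1`, `‖Ū₀ʲ(∂p) − 1‖ ≤ 2α₀(Lʲη)²` for `j < k`), (176) `SiteBd u′ α₄`,
(177) `CovBondBd U₀ u′ (α₄η)`, (166)/(167) `u₁ ∈ Λ_k(U₀, α₃)`, `L ≥ 2`, `0 ≤ η`, `Lᵏη ≤ 1`, and the smallness `20C₅α₄ ≤ 1`,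
`200dLα₄ ≤ 1`, `C₄(α₀ + α₃ + α₄) ≤ 1`, `α₃ ≤ 1/50`, `1024(d+1)(d+4)L²α₀ ≤ 1`: for every `j ≤ k`,
(203) `‖ũ′ʲ(c₋)⁻¹R̄ʲ_{0,c}ũ′ʲ(c₊) − 1‖ ≤ α₄Lʲη + C₄(α₀α₄ + α₃α₄ + α₄²)(Lʲη)²` with `C₄ = 8C′₄C₅` (`B7Prop10Flat.C4`) and
(204) `‖ũ′ʲ − 1‖ ≤ α₄ + 2C′₅α₄(Lη + … + Lʲη)` (`B7Prop10Flat.rhs204`).  Induction as printed: (203)ⱼ₊₁ from `prop9_printed_C4'` at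
`V₀ = Ū₀ʲ` + `ineq205_printed`; (204)ⱼ₊₁ from `B7Ineq200General.siteBd_vtilG_printed` + (206).
[cite: Balaban1985Averaging, Proposition 10 p.50, (203)–(206) p.49] -/
theorem prop10_as_printed {L : ℕ} (hL : 2 ≤ L) {U₀ : Site d → Fin d → 𝔸ˣ} {k : ℕ} {u' u₁ : Site d → 𝔸ˣ}
    {α₀ α₃ α₄ η : ℝ}
    (hV : ∀ j < k, ∀ (x : Site d) (κ : Fin d), avgIter L U₀ j x κ ∈ U1 𝔸)
    (h52 : ∀ j < k, ∀ (x : Site d) (κ μ : Fin d), κ ≠ μ →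
      ‖((hol (avgIter L U₀ j) x (plaqWord κ μ) : 𝔸ˣ) : 𝔸) - 1‖ ≤ 2 * α₀ * ((L : ℝ) ^ j * η) ^ 2)
    (h176 : SiteBd u' α₄) (h177 : CovBondBd U₀ u' (α₄ * η)) (hu₁ : InLambda L U₀ u₁ k α₃ η)
    (hη : 0 ≤ η) (hk : (L : ℝ) ^ k * η ≤ 1) (hα₀ : 0 ≤ α₀) (hα₃ : 0 ≤ α₃) (hα₃' : α₃ ≤ 1 / 50) (hα₄ : 0 ≤ α₄)
    (hs₁ : 20 * C5 d * α₄ ≤ 1) (hs₂ : 200 * (d : ℝ) * L * α₄ ≤ 1) (hs₃ : C4 d * (α₀ + α₃ + α₄) ≤ 1)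
    (hs₄ : 1024 * ((d : ℝ) + 1) * ((d : ℝ) + 4) * L ^ 2 * α₀ ≤ 1) :
    ∀ j ≤ k, CovBondBd (avgIter L U₀ j) (utilG L U₀ u' u₁ j)
        (α₄ * ((L : ℝ) ^ j * η) + C4 d * (α₀ * α₄ + α₃ * α₄ + α₄ ^ 2) * ((L : ℝ) ^ j * η) ^ 2) ∧
      SiteBd (utilG L U₀ u' u₁ j) (rhs204 d L j α₄ η) := by
  have h5' := C5'_nonneg (d := d)
  have h4' := C4'_nonneg (d := d)
  have hC5 := one_le_C5 (d := d)
  have hC40 : 0 ≤ C4 d := by unfold C4; positivity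
  have hL1 : 1 ≤ L := le_trans (by norm_num) hL
  have hLr : (2 : ℝ) ≤ L := by exact_mod_cast hL
  have hd : (0 : ℝ) ≤ d := Nat.cast_nonneg d
  have h167 : ∀ j < k, ∀ (z : Site d) (r : Fin d → Fin L),
      ‖((((uavg L U₀ u₁ j ((L : ℤ) • z))⁻¹ *
          R0fun (avgIter L U₀ j) ((L : ℤ) • z) (uavg L U₀ u₁ j) ((L : ℤ) • z + boxVec L r) : 𝔸ˣ)) : 𝔸) - 1‖
        ≤ α₃ * (L : ℝ) ^ (j + 1) * η := by
    have h := hu₁.2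
    simp only [Cond167, R0fun_add] at h ⊢
    exact h
  intro j hj
  induction j with
  | zero =>
    refine ⟨?_, ?_⟩
    · rw [utilG_zero, avgIter_zero, pow_zero, one_mul]
      refine covBondBd_mono h177 ?_
      have : 0 ≤ C4 d * (α₀ * α₄ + α₃ * α₄ + α₄ ^ 2) * η ^ 2 := by positivity
      linarith
    · rw [utilG_zero, rhs204_zero]; exact h176
  | succ j ih =>
    have hjk : j < k := hj
    obtain ⟨hB, hS⟩ := ih hjk.le
    have ht := (pow_eta_le hL1 hη hk hjk.le).1
    have hLt : (L : ℝ) ^ (j + 1) * η ≤ 1 := (pow_eta_le hL1 hη hk (Nat.succ_le_of_lt hjk)).1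
    have hLt' : (L : ℝ) * ((L : ℝ) ^ j * η) ≤ 1 := by rw [← mul_assoc, ← pow_succ']; exact hLt
    have ht0 : 0 ≤ (L : ℝ) ^ j * η := by positivity
    set t := (L : ℝ) ^ j * η with ht_def
    set A : ℝ := α₄ * t + C4 d * (α₀ * α₄ + α₃ * α₄ + α₄ ^ 2) * t ^ 2 with hAdef
    have hA : A ≤ 2 * α₄ * t := rhs203_printed_le ht0 ht hα₄ hs₃
    have hA0 : 0 ≤ A := by rw [hAdef]; positivity
    -- `T = (204)ⱼ ≤ C₅α₄ ≤ 1/20`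
    have hT : rhs204 d L j α₄ η ≤ C5 d * α₄ := rhs204_le (d := d) hL hα₄ hη ht
    have hT0 : 0 ≤ rhs204 d L j α₄ η := (norm_nonneg _).trans (hS 0)
    have hα₄j : rhs204 d L j α₄ η ≤ 1 / 20 := hT.trans (by linarith)
    -- level-`j` data
    set V : Site d → Fin d → 𝔸ˣ := avgIter L U₀ j with hVdef
    set α₀j : ℝ := 2 * α₀ * t ^ 2 with hα₀j
    have hα₀j0 : 0 ≤ α₀j := by positivity
    have hVU : ∀ x κ, V x κ ∈ U1 𝔸 := hV j hjk
    have h44 : ∀ (x : Site d) (κ μ : Fin d), κ ≠ μ → ‖((hol V x (plaqWord κ μ) : 𝔸ˣ) : 𝔸) - 1‖ ≤ α₀j :=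
      fun x κ μ hκμ => h52 j hjk x κ μ hκμ
    have h3c : SiteBd (uavg L U₀ u₁ j) α₃ := fun z => hu₁.1 j hjk.le z
    have h3d : CovBlockBd L V (uavg L U₀ u₁ j) (L * (α₃ * t)) := by
      intro z r
      have := h167 j hjk z r
      calc _ ≤ α₃ * (L : ℝ) ^ (j + 1) * η := this
        _ = L * (α₃ * t) := by rw [ht_def]; ring
    have hq : 50 * (L * (α₃ * t)) ≤ 1 := by
      have e : L * (α₃ * t) = α₃ * (L * t) := by ring
      have h1 : α₃ * (L * t) ≤ α₃ * 1 := mul_le_mul_of_nonneg_left hLt' hα₃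
      rw [e]; linarith
    -- smallness of Proposition 9 at step `j`
    have ht2 : t ^ 2 ≤ t := by nlinarith
    have hs : 100 * ((d : ℝ) * L * A) ≤ 1 := by
      have h1 : (d : ℝ) * L * A ≤ (d : ℝ) * L * (2 * α₄ * t) := mul_le_mul_of_nonneg_left hA (by positivity)
      have h2 : (d : ℝ) * L * (2 * α₄ * t) ≤ (d : ℝ) * L * (2 * α₄ * 1) :=
        mul_le_mul_of_nonneg_left (mul_le_mul_of_nonneg_left ht (by positivity)) (by positivity)
      have e1 : 100 * ((d : ℝ) * L * (2 * α₄ * 1)) = 200 * (d : ℝ) * L * α₄ := by ring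
      linarith
    have hα₀s : 512 * ((d : ℝ) + 1) * ((d : ℝ) + 4) * L ^ 2 * α₀j ≤ 1 := by
      have : 512 * ((d : ℝ) + 1) * ((d : ℝ) + 4) * L ^ 2 * α₀j =
          1024 * ((d : ℝ) + 1) * ((d : ℝ) + 4) * L ^ 2 * α₀ * t ^ 2 := by rw [hα₀j]; ring
      rw [this]
      have h0 : 0 ≤ 1024 * ((d : ℝ) + 1) * ((d : ℝ) + 4) * (L : ℝ) ^ 2 * α₀ := by positivity
      linarith [mul_le_mul_of_nonneg_left (ht2.trans ht) h0]
    -- (203)-step: Proposition 9 in print's shape at step `j`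
    have h9 := prop9_printed_C4' hL1 hVU hα₀j0 h44 hS hB h3c h3d hα₄j hA0 hα₃' hq hs hα₀s
    have eV : rescale L (bavg L V) = avgIter L U₀ (j + 1) := by rw [hVdef, avgIter_succ]
    have eU : (fun z => vtilG L V (utilG L U₀ u' u₁ j) (uavg L U₀ u₁ j) ((L : ℤ) • z)) = utilG L U₀ u' u₁ (j + 1) := by
      rw [utilG_succ]
    rw [eV, eU] at h9
    -- (204)-step: the α₀-free one-step (200) at step `j`
    have h200 := siteBd_vtilG_printed hL1 hVU hS hB h3c h3d (hα₄j.trans (by norm_num)) hA0 hα₃'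
      (by linarith : L * (α₃ * t) ≤ 1 / 50) hs
    rw [eU] at h200
    refine ⟨covBondBd_mono h9.1 ?_, siteBd_mono h200 ?_⟩
    · -- (205)
      have h205 := ineq205_printed (d := d) hL ht0 ht hα₀ hα₃ hα₄ hT0 hT hs₃
      have e : (L : ℝ) ^ (j + 1) * η = L * t := by rw [ht_def]; ring
      rw [e, hα₀j]
      exact le_trans (le_of_eq rfl) h205
    · -- (206): `(204)ⱼ + 6dL·(203)ⱼ ≤ (204)ⱼ + 12dα₄L^{j+1}η ≤ (204)ⱼ + 2C′₅α₄L^{j+1}η = (204)ⱼ₊₁`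
      rw [rhs204_succ]
      have h1 : 6 * (d : ℝ) * L * A ≤ 6 * d * L * (2 * α₄ * t) := mul_le_mul_of_nonneg_left hA (by positivity)
      have h2 : 6 * (d : ℝ) * L * (2 * α₄ * t) = 12 * d * α₄ * ((L : ℝ) ^ (j + 1) * η) := by rw [ht_def]; ring
      have h3 : 12 * (d : ℝ) * α₄ * ((L : ℝ) ^ (j + 1) * η) ≤ 2 * C5' d * α₄ * ((L : ℝ) ^ (j + 1) * η) := by
        have hc : 12 * (d : ℝ) ≤ 2 * C5' d := by unfold C5'; linarith
        have h0 : 0 ≤ α₄ * ((L : ℝ) ^ (j + 1) * η) := by positivity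
        calc 12 * (d : ℝ) * α₄ * ((L : ℝ) ^ (j + 1) * η) = (12 * (d : ℝ)) * (α₄ * ((L : ℝ) ^ (j + 1) * η)) := by ring
          _ ≤ (2 * C5' d) * (α₄ * ((L : ℝ) ^ (j + 1) * η)) := mul_le_mul_of_nonneg_right hc h0
          _ = 2 * C5' d * α₄ * ((L : ℝ) ^ (j + 1) * η) := by ring
      linarith

/-- **Proposition 10 as printed, closed forms** (p. 49: the right-hand side of (203) "can be bounded by `2α₄`" — here `2α₄Lʲη` —,
that of (204) "by `α₄(1 + 4C′₅) = C₅α₄`"): for all `j ≤ k`, `‖ũ′ʲ(c₋)⁻¹R̄ʲ_{0,c}ũ′ʲ(c₊) − 1‖ ≤ 2α₄Lʲη` and `‖ũ′ʲ − 1‖ ≤ C₅α₄`.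
[cite: Balaban1985Averaging, Proposition 10 p.50, (203)–(204) p.49] -/
theorem prop10_as_printed' {L : ℕ} (hL : 2 ≤ L) {U₀ : Site d → Fin d → 𝔸ˣ} {k : ℕ} {u' u₁ : Site d → 𝔸ˣ}
    {α₀ α₃ α₄ η : ℝ}
    (hV : ∀ j < k, ∀ (x : Site d) (κ : Fin d), avgIter L U₀ j x κ ∈ U1 𝔸)
    (h52 : ∀ j < k, ∀ (x : Site d) (κ μ : Fin d), κ ≠ μ →
      ‖((hol (avgIter L U₀ j) x (plaqWord κ μ) : 𝔸ˣ) : 𝔸) - 1‖ ≤ 2 * α₀ * ((L : ℝ) ^ j * η) ^ 2)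
    (h176 : SiteBd u' α₄) (h177 : CovBondBd U₀ u' (α₄ * η)) (hu₁ : InLambda L U₀ u₁ k α₃ η)
    (hη : 0 ≤ η) (hk : (L : ℝ) ^ k * η ≤ 1) (hα₀ : 0 ≤ α₀) (hα₃ : 0 ≤ α₃) (hα₃' : α₃ ≤ 1 / 50) (hα₄ : 0 ≤ α₄)
    (hs₁ : 20 * C5 d * α₄ ≤ 1) (hs₂ : 200 * (d : ℝ) * L * α₄ ≤ 1) (hs₃ : C4 d * (α₀ + α₃ + α₄) ≤ 1)
    (hs₄ : 1024 * ((d : ℝ) + 1) * ((d : ℝ) + 4) * L ^ 2 * α₀ ≤ 1) :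
    ∀ j ≤ k, CovBondBd (avgIter L U₀ j) (utilG L U₀ u' u₁ j) (2 * α₄ * ((L : ℝ) ^ j * η)) ∧
      SiteBd (utilG L U₀ u' u₁ j) (C5 d * α₄) := by
  intro j hj
  have hL1 : 1 ≤ L := le_trans (by norm_num) hL
  have ht := (pow_eta_le hL1 hη hk hj).1
  have ht0 : 0 ≤ (L : ℝ) ^ j * η := by positivity
  obtain ⟨hB, hS⟩ := prop10_as_printed hL hV h52 h176 h177 hu₁ hη hk hα₀ hα₃ hα₃' hα₄ hs₁ hs₂ hs₃ hs₄ j hj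
  exact ⟨covBondBd_mono hB (rhs203_printed_le ht0 ht hα₄ hs₃), siteBd_mono hS (rhs204_le hL hα₄ hη ht)⟩

/-- **Proposition 10 as printed, under (52)** — the level hypotheses discharged by Proposition 2 (`B7Prop10General.levels_of52`): for
`U₀` with values in an average-closed subgroup `G ⊂ U1` satisfying (52) `sup_p‖U₀(∂p) − 1‖ < α₀η²`, `η = L^{−k}`, and `u′, u₁` with
(176), (177), (166)–(167): for all `j ≤ k`, (203) `≤ α₄Lʲη + C₄(α₀α₄ + α₃α₄ + α₄²)(Lʲη)²` and (204) `≤ α₄ + 2C′₅α₄(Lη + … + Lʲη)`.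
[cite: Balaban1985Averaging, Proposition 10 p.50, Proposition 2 p.26, (203)–(204) p.49] -/
theorem prop10_as_printed_of52 {L : ℕ} (hL : 2 ≤ L) {G : Subgroup 𝔸ˣ} (hG : AvgClosed d L G) {U₀ : Site d → Fin d → 𝔸ˣ}
    (hU : ∀ x κ, U₀ x κ ∈ G) {k : ℕ} {u' u₁ : Site d → 𝔸ˣ} {α₀ α₃ α₄ : ℝ}
    (hα : 0 < α₀) (hα3 : C0 d * α₀ ≤ 1 / 3) (hα2 : 2 * α₀ ≤ c2' d L)
    (h52 : pdev U₀ < α₀ * (((L : ℝ) ^ k)⁻¹) ^ 2)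
    (h176 : SiteBd u' α₄) (h177 : CovBondBd U₀ u' (α₄ * ((L : ℝ) ^ k)⁻¹))
    (hu₁ : InLambda L U₀ u₁ k α₃ (((L : ℝ) ^ k)⁻¹))
    (hα₃ : 0 ≤ α₃) (hα₃' : α₃ ≤ 1 / 50) (hα₄ : 0 ≤ α₄)
    (hs₁ : 20 * C5 d * α₄ ≤ 1) (hs₂ : 200 * (d : ℝ) * L * α₄ ≤ 1) (hs₃ : C4 d * (α₀ + α₃ + α₄) ≤ 1)
    (hs₄ : 1024 * ((d : ℝ) + 1) * ((d : ℝ) + 4) * L ^ 2 * α₀ ≤ 1) :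
    ∀ j ≤ k, CovBondBd (avgIter L U₀ j) (utilG L U₀ u' u₁ j)
        (α₄ * ((L : ℝ) ^ j * ((L : ℝ) ^ k)⁻¹) +
          C4 d * (α₀ * α₄ + α₃ * α₄ + α₄ ^ 2) * ((L : ℝ) ^ j * ((L : ℝ) ^ k)⁻¹) ^ 2) ∧
      SiteBd (utilG L U₀ u' u₁ j) (rhs204 d L j α₄ (((L : ℝ) ^ k)⁻¹)) := by
  obtain ⟨hV, hP⟩ := levels_of52 hL hG hU k hα hα3 hα2 h52
  have hη : (0 : ℝ) ≤ ((L : ℝ) ^ k)⁻¹ := by positivity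
  have hk : (L : ℝ) ^ k * ((L : ℝ) ^ k)⁻¹ ≤ 1 := by rw [mul_inv_cancel₀ (by positivity)]
  exact prop10_as_printed hL (fun j hj => hV j hj.le) (fun j hj => hP j hj.le) h176 h177 hu₁ hη hk hα.le hα₃ hα₃' hα₄
    hs₁ hs₂ hs₃ hs₄

/-! ## §4 "`u′` belongs to the class `Λ_k(C₅α₄)`" with print's `C₅` -/

omit [NormOneClass 𝔸] [NormedAlgebra ℂ 𝔸] [CompleteSpace 𝔸] in
/-- `4d ≤ C₅ = 1 + 256(d+1)`. [cite: Balaban1985Averaging, Proposition 10 p.50] -/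
private theorem four_d_le_C5 : 4 * (d : ℝ) ≤ C5 d := by
  unfold C5 C5'
  have hd : (0 : ℝ) ≤ d := Nat.cast_nonneg d
  nlinarith

/-- **p. 50: "This result implies in particular that the configuration `u′` belongs to the class `Λ_k(C₅α₄)`" — WITH PRINT'S
`C₅ = 1 + 4C′₅`** (`B7Prop10Flat.C5`; compare `B7Prop10InLambda.inLambda_of_prop10_general` with `C₆ = C₅ + 1`): under the hypotheses of
`prop10_as_printed` taken with `u₁ = 1` (so `α₃ = 0`), `u′ ∈ Λ_k(U₀, C₅α₄)`, i.e. `B7Eq167Flat.InLambda L U₀ u′ k (C5 d * α₄) η`: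
(166) is (204) `≤ C₅α₄` for `ũ′ʲ = \overline{R₀u′}ʲ` (`utilG_one_right`); (167) is (203) `≤ 2α₄Lʲη` summed covariantly along the tree
contour (`covBlock_of_covBondBd`: `≤ 4dα₄L^{j+1}η`) and `4d ≤ C₅`. [cite: Balaban1985Averaging, Proposition 10 p.50, (166)–(167) p.44, (203)–(204) p.49] -/
theorem inLambda_C5_of_prop10 {L : ℕ} (hL : 2 ≤ L) {U₀ : Site d → Fin d → 𝔸ˣ} {k : ℕ} {u' : Site d → 𝔸ˣ}
    {α₀ α₄ η : ℝ}
    (hV : ∀ j < k, ∀ (x : Site d) (κ : Fin d), avgIter L U₀ j x κ ∈ U1 𝔸)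
    (h52 : ∀ j < k, ∀ (x : Site d) (κ μ : Fin d), κ ≠ μ →
      ‖((hol (avgIter L U₀ j) x (plaqWord κ μ) : 𝔸ˣ) : 𝔸) - 1‖ ≤ 2 * α₀ * ((L : ℝ) ^ j * η) ^ 2)
    (h176 : SiteBd u' α₄) (h177 : CovBondBd U₀ u' (α₄ * η))
    (hη : 0 ≤ η) (hk : (L : ℝ) ^ k * η ≤ 1) (hα₀ : 0 ≤ α₀) (hα₄ : 0 ≤ α₄)
    (hs₁ : 20 * C5 d * α₄ ≤ 1) (hs₂ : 200 * (d : ℝ) * L * α₄ ≤ 1) (hs₃ : C4 d * (α₀ + α₄) ≤ 1)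
    (hs₄ : 1024 * ((d : ℝ) + 1) * ((d : ℝ) + 4) * L ^ 2 * α₀ ≤ 1) :
    InLambda L U₀ u' k (C5 d * α₄) η := by
  have hL1 : 1 ≤ L := le_trans (by norm_num) hL
  have hLr : (1 : ℝ) ≤ L := by exact_mod_cast hL1
  have hd : (0 : ℝ) ≤ d := Nat.cast_nonneg d
  have hs₃' : C4 d * (α₀ + 0 + α₄) ≤ 1 := by rwa [add_zero]
  have hP := prop10_as_printed' hL hV h52 h176 h177 (inLambda_one L U₀ k le_rfl hη) hη hk hα₀ le_rfl (by norm_num) hα₄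
    hs₁ hs₂ hs₃' hs₄
  refine ⟨fun j hj z => ?_, fun j hj z r => ?_⟩
  · have h := (hP j hj).2 z
    rwa [utilG_one_right] at h
  · have h203 : CovBondBd (avgIter L U₀ j) (uavg L U₀ u' j) (2 * α₄ * ((L : ℝ) ^ j * η)) := by
      have h := (hP j hj.le).1
      rwa [utilG_one_right] at h
    have ht : (L : ℝ) ^ (j + 1) * η ≤ 1 :=
      le_trans (mul_le_mul_of_nonneg_right (pow_le_pow_right₀ hLr (Nat.succ_le_of_lt hj)) hη) hk
    have hsmall : (d : ℝ) * L * (2 * α₄ * ((L : ℝ) ^ j * η)) ≤ 1 := by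
      have e : (d : ℝ) * L * (2 * α₄ * ((L : ℝ) ^ j * η)) = 2 * d * α₄ * ((L : ℝ) ^ (j + 1) * η) := by ring
      rw [e]
      have h2d : 2 * (d : ℝ) * α₄ ≤ 1 := by nlinarith
      calc 2 * (d : ℝ) * α₄ * ((L : ℝ) ^ (j + 1) * η) ≤ 1 * 1 :=
            mul_le_mul h2d ht (by positivity) (by norm_num)
        _ = 1 := one_mul 1
    have hw := covBlock_of_covBondBd (hV j hj) h203 (by positivity) hsmall ((L : ℤ) • z) r
    have e : 2 * ((d : ℝ) * L * (2 * α₄ * ((L : ℝ) ^ j * η))) = 4 * d * α₄ * ((L : ℝ) ^ (j + 1) * η) := by ring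
    rw [e] at hw
    refine hw.trans ?_
    have hC := four_d_le_C5 (d := d)
    calc 4 * (d : ℝ) * α₄ * ((L : ℝ) ^ (j + 1) * η) = (4 * d) * (α₄ * ((L : ℝ) ^ (j + 1) * η)) := by ring
      _ ≤ C5 d * (α₄ * ((L : ℝ) ^ (j + 1) * η)) := mul_le_mul_of_nonneg_right hC (by positivity)
      _ = C5 d * α₄ * (L : ℝ) ^ (j + 1) * η := by ring

end Literature.MathematicalPhysics.QuantumFieldTheory.Balaban1983to89.B7Prop10AsPrinted

end
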